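import Summits.BirchSwinnertonDyer.BirchSwinnertonDyer.Theorems.EisensteinPrimesAlgebraicLambdaGEIsogeny
import Summits.BirchSwinnertonDyer.BirchSwinnertonDyer.Theorems.EisensteinPrimesAnalyticLambdaCruxSized
import Summits.BirchSwinnertonDyer.Rank1Residual.X1.GeneratorCountTamagawa
import Summits.BirchSwinnertonDyer.Rank1Residual.X1.GeneratorCountLambda
import Summits.BirchSwinnertonDyer.Rank1Residual.X1.GeneratorBoundMu
import Summits.BirchSwinnertonDyer.Rank1Residual.X2.CongruenceTransfer
import Literature.NumberTheory.EllipticCurves.Greenberg1999.NoProperFiniteIndexSubmoduleOrdinary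
import HarnessLib

/-!
# The λ-conjunct `AlgebraicLambdaGE W₀ p k` of `stub_lambdaCount_offLocus` FROM THE KERNEL'S TAMAGAWA
# BUDGETS — Greenberg's Cor. 5.6 / p. 137 road at a MULTIPLICATIVE (and at a good ordinary) Eisenstein
# prime, delivered in the currency the `mudescent` skeletons consume (route `EisensteinPrimes`, cruxes
# 3 / 5; seat bsd-eis-lam-b g2, PROGRAMME PART 1b seat (5), ALGEBRAIC side)

HONEST FRAMING (cell `bsd-eis`, programme §HONESTY: no tranche here proves BSD; this file moves
nothing between columns by itself): THEOREMS ONLY — no definition, no named fact, nothing asserted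
about any particular curve, closes nothing. The class-wide statement of stub 4 at type A IS the
`λ`-half of Mazur's main conjecture at the étale end (lam-a's `lambdaCount_iff_mazurMainConjectureAt`,
lam-b MEMO-1 §0) and stays OPEN; what this file supplies is the PER-PAIR algebraic certificate in the
stub's own currency.

WHY. The typed input `X1.TamagawaSqueeze.AlgebraicLambdaGE W p k` ("`λ(X(E/ℚ_∞)) ≥ k` for EVERY
cyclotomic `κ`, EVERY topological generator `γ`, every torsion dual datum") had exactly three
producers in the tree: `k = 0`, Greenberg's Thm. 1.9 (rank growth, `algebraicLambdaGE_of_layerRankGEAt`)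
and the isogeny transport of file `EisensteinPrimesAlgebraicLambdaGEIsogeny` (lam-b g0). Greenberg's
Cor. 5.6 mechanism (LNM 1716 §5 pp. 114–118 with the generator inequality of p. 137: Tamagawa
witnesses at the bad `ℓ ≠ p` with `p ∣ c_ℓ` ⇒ `#(X/𝔪X) ≥ p^B` ⇒ `λ + μ ≥ B`) exists in the kernel
in three OTHER currencies — n1011's `Additive.BudgetLeLambdaAt p W b` (`μ = 0` as a hypothesis),
eisenstein-p1's `X1.GeneratorCountSqueeze.GeneratorCountGE W p B` / `X1.GeneratorSqueeze.AlgebraicLambdaMem`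
— all three stated at the NORMALISED generator (`IsCyclotomicVariable p γ`) only, and discharged to
`λ` only at GOOD ORDINARY `p` (`X1.GeneratorCountLambda`). At `p ‖ N` the b2b cell's route T
(`X2/TamagawaSqueeze.lean`) says verbatim «Nothing of this recipe is asserted here: `AlgebraicLambdaGE`
is a TYPED input» (its census `routeT_X2.py` supplied it outside the kernel). This file closes that
glue gap and writes the MULTIPLICATIVE dischargers:

* §1 (class-agnostic) `algebraicLambdaGE_of_forall_normalised` — a bound proved at the normalised
  cyclotomic datum is a bound at every `(κ, γ)` (lam-a's `lambdaInvariant_eq_of_kerSubgroup_eq`: `λ`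
  sees only the `ℤ_p`-structure); hence `AlgebraicLambdaGE` from `AlgebraicLambdaMem (Ici k)`, from
  `BudgetLeLambdaAt` (given `μ = 0` at the normalised datum), from `GeneratorCountGE` (given `μ = 0`
  and no finite submodule: `#(X/𝔪X) ≤ p^λ`), and — the `μ ≥ 1` members — `AlgebraicLambdaGE W p (B − m)`
  from `GeneratorCountGE W p B` at a datum with `μ(X) ≤ m` (Greenberg's inequality
  `#(X/𝔪X) ≤ p^{λ+μ}`, tree `X1.GeneratorBoundMu`).
* §2 (X2, `p ‖ N` odd, `E[p]` reducible) `X2.isTorsion_and_mu_le_of_analyticMuLE` — `X2.AnalyticMuLE W p m`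
  (the cell's two-engine certificate) + Wuthrich Thm. 16 ⇒ `X` torsion and `μ(X) ≤ m` (Kato's
  direction only); `noFiniteSubmoduleAt_of_prop415ii_mult` (Prop. 4.15 (ii) BY NAME at `p ‖ N`);
  the dischargers `X2.algebraicLambdaGE_of_budgetLeLambdaAt_of_analyticMuLE_zero`,
  `…_of_generatorCountGE_of_analyticMuLE`, `…_of_algebraicLambdaMem_Ici_of_analyticMuLE`; and END-TO-END: `X2.algebraicLambdaGE_of_dvd_localTamagawaNumber`
  (`p ∤ #E(ℚ)_tors`, `S = {v ∤ p : p ∣ c_v}`, `μ_an ≤ m` ⇒ `AlgebraicLambdaGE W p (#S − m)`, layer `0`)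
  and `X2.algebraicLambdaGE_layer_of_certificates` (the tower count `Σ_v p^{min(n, m_v)}` at a
  `μ_an = 0` member, n1011's no-Tate layer budget), both transported to any isogenous member — in
  particular to the located `W₀` of `stub_locate` — by g0's `algebraicLambdaGE_of_isIsogenous`.
* X1 twin (good ordinary, `E[p]` reducible; crux-5 currency `X1.MuPart.AnalyticMuLE W p m` +
  Wuthrich Thm. 16): companion file `Theorems/EisensteinPrimesX1AlgebraicLambdaGEBudget.lean`.

Named PUBLISHED facts appear as hypotheses exactly as in the files composed: Poitou–Tate duality for
Selmer structures over `ℚ` / `ℚ_n` (`hPT`), the local Euler–Poincaré formula over `ℚ_n` (`hEP`; over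
`ℚ` a tree theorem), Greenberg 1999 Prop. 4.14 (`h414`) / Prop. 4.15 (ii) (`h415`), Wuthrich 2014
Thm. 16 (`hWu` multiplicative / `hW16` good ordinary), modularity (`hpar` / `hmod`).

NOT HERE: the `δ = 1` count (a rational point of order `p`, i.e. the `φ = 𝟙` étale ends of type-A
classes) at `p ‖ N` — the tree has it at good ordinary `p` only (`X1/GeneratorCountTorsion*`); and the
`a`-term at the multiplicative prime itself (Greenberg pp. 91–93). Both are the next files of this seat.

References: [GreenbergLNM1716] §3 p. 88, §4 Prop. 4.14 / 4.15, §5 pp. 114–118 (proof of Cor. 5.6),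
p. 137 (λ + μ ≥ dim X/𝔪X); [Washington1997] §13.2; [Wuthrich2014] Thm. 16; [GreenbergVatsal2000]
p. 2 (1)–(2), p. 28; HOME/b2b-bsdres-eisenstein-p2/routeT/README.md (recipe, census);
HOME/lam-b-MEMO-1.md; `Theorems/EisensteinPrimesAnalyticLambdaCruxSized.lean` (lam-a).
-/

set_option autoImplicit false
-- `Summit.BirchSwinnertonDyer.BirchSwinnertonDyer.…`: the summit and its single sub-problem share a name (D-0017 layout).
set_option linter.dupNamespace false

noncomputable section

open scoped Classical MatrixGroups ModularForm

open PowerSeries CongruenceSubgroup WeierstrassCurve NumberField IsDedekindDomain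
  Literature.NumberTheory.EllipticCurves Literature.NumberTheory.GaloisRepresentations
  Literature.NumberTheory.EllipticCurves.ModularForms
  Literature.NumberTheory.EllipticCurves.Rank1Residual
  Literature.NumberTheory.EllipticCurves.Wuthrich2014
  Literature.NumberTheory.EllipticCurves.Greenberg1999
  Literature.NumberTheory.GaloisCohomology
  Summit.BirchSwinnertonDyer.Rank1Residual
  Summit.BirchSwinnertonDyer.Rank1Residual.X1.MuLambda
  Summit.BirchSwinnertonDyer.Rank1Residual.X1.TamagawaSqueeze
  Summit.BirchSwinnertonDyer.Rank1Residual.X1.GeneratorSqueeze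
  Summit.BirchSwinnertonDyer.Rank1Residual.X1.GeneratorCountSqueeze
  Summit.BirchSwinnertonDyer.Rank1Residual.Additive
  Summit.BirchSwinnertonDyer.BirchSwinnertonDyer.Theorems.EisensteinPrimesAnalyticLambdaCruxSized
  Summit.BirchSwinnertonDyer.BirchSwinnertonDyer.Theorems.EisensteinPrimesAlgebraicLambdaGEIsogeny

namespace Summit.BirchSwinnertonDyer.BirchSwinnertonDyer.Theorems.EisensteinPrimesAlgebraicLambdaGEBudget

variable {W W' : WeierstrassCurve ℚ} [W.IsElliptic] [W.IsGloballyMinimal] [W'.IsElliptic]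
  [W'.IsGloballyMinimal] {p : ℕ} [hp : Fact p.Prime]

/-! ## §1. Class-agnostic glue: from the normalised cyclotomic datum to `AlgebraicLambdaGE` -/

/-- **A λ-lower bound at the NORMALISED cyclotomic datum is a bound at every `(κ, γ)`.** If
`k ≤ λ(D₀.X)` for every dual datum `D₀` over every cyclotomic `κ₀` with a topological generator `γ₀`
that is a cyclotomic variable, then `AlgebraicLambdaGE W p k` (all cyclotomic `κ`, ALL `γ`, all
torsion data): `λ(D.X) = λ(D₀.X)` whenever `ker κ = ker κ₀` (lam-a's `lambdaInvariant_eq_of_kerSubgroup_eq`;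
`IsCyclotomic` is an equation for `ker κ`), and a normalised datum exists
(`exists_isCyclotomic_isTopGenerator_isCyclotomicVariable_holds`, `nonempty_selmerDualData_holds`).
The torsion hypothesis of `AlgebraicLambdaGE` is not even used. [folklore] -/
theorem algebraicLambdaGE_of_forall_normalised {k : ℕ}
    (h : ∀ (κ : ZpExtension ℚ p) (γ : Field.absoluteGaloisGroup ℚ), κ.IsCyclotomic →
      κ.IsTopGenerator γ → IsCyclotomicVariable p γ →
      ∀ (D : W.SelmerDualData κ γ) [Module.Finite (IwasawaAlgebra p) D.X], k ≤ lambdaInvariant p D.X) :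
    AlgebraicLambdaGE W p k := by
  intro κ γ hκ _ D _ _
  obtain ⟨κ₀, hκ₀, γ₀, hγ₀, hγ₀'⟩ := exists_isCyclotomic_isTopGenerator_isCyclotomicVariable_holds p
  obtain ⟨D₀⟩ := W.nonempty_selmerDualData_holds κ₀ γ₀ hγ₀
  haveI : Module.Finite (IwasawaAlgebra p) D₀.X := D₀.module_finite_holds hγ₀
  rw [lambdaInvariant_eq_of_kerSubgroup_eq D D₀ (hκ.trans hκ₀.symm)]
  exact h κ₀ γ₀ hκ₀ hγ₀ hγ₀' D₀

/-- **Route M's membership certificate `λ_alg ∈ [k, ∞)` IS route T's `AlgebraicLambdaGE W p k`**, once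
`X(E/ℚ_∞)` is known to be torsion at the normalised data (Kato–Wuthrich on every Eisenstein pair).
The converse `AlgebraicLambdaMem.of_algebraicLambdaGE` is in `X1/GeneratorSqueeze.lean`. [folklore] -/
theorem algebraicLambdaGE_of_algebraicLambdaMem_Ici {k : ℕ}
    (htor : ∀ (κ : ZpExtension ℚ p) (γ : Field.absoluteGaloisGroup ℚ), κ.IsCyclotomic →
      κ.IsTopGenerator γ → IsCyclotomicVariable p γ →
      ∀ (D : W.SelmerDualData κ γ) [Module.Finite (IwasawaAlgebra p) D.X], D.IsTorsion)
    (h : AlgebraicLambdaMem W p (Set.Ici k)) : AlgebraicLambdaGE W p k :=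
  algebraicLambdaGE_of_forall_normalised fun κ γ hκ hγ hγ' D _ ↦
    Set.mem_Ici.mp (h κ γ hκ hγ hγ' D (htor κ γ hκ hγ hγ' D))

/-- Under torsion at the normalised data, `AlgebraicLambdaGE W p k ↔ AlgebraicLambdaMem W p [k, ∞)`.
[folklore] -/
theorem algebraicLambdaGE_iff_algebraicLambdaMem_Ici {k : ℕ}
    (htor : ∀ (κ : ZpExtension ℚ p) (γ : Field.absoluteGaloisGroup ℚ), κ.IsCyclotomic →
      κ.IsTopGenerator γ → IsCyclotomicVariable p γ →
      ∀ (D : W.SelmerDualData κ γ) [Module.Finite (IwasawaAlgebra p) D.X], D.IsTorsion) :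
    AlgebraicLambdaGE W p k ↔ AlgebraicLambdaMem W p (Set.Ici k) :=
  ⟨AlgebraicLambdaMem.of_algebraicLambdaGE, algebraicLambdaGE_of_algebraicLambdaMem_Ici htor⟩

/-- **n1011's budget `BudgetLeLambdaAt p W b` is `AlgebraicLambdaGE W p b` at a member where `X` is
torsion with `μ = 0` at the normalised data** (the budget carries `μ = 0` as a hypothesis; here it is
supplied). [cite: GreenbergLNM1716, §5 pp. 114–118 and p. 137] -/
theorem algebraicLambdaGE_of_budgetLeLambdaAt {b : ℕ}
    (hμ : ∀ (κ : ZpExtension ℚ p) (γ : Field.absoluteGaloisGroup ℚ), κ.IsCyclotomic →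
      κ.IsTopGenerator γ → IsCyclotomicVariable p γ →
      ∀ (D : W.SelmerDualData κ γ) [Module.Finite (IwasawaAlgebra p) D.X], D.IsTorsion ∧ D.mu = 0)
    (hb : BudgetLeLambdaAt p W b) : AlgebraicLambdaGE W p b :=
  algebraicLambdaGE_of_forall_normalised fun κ γ hκ hγ hγ' D _ ↦
    hb hκ hγ hγ' D (hμ κ γ hκ hγ hγ' D).1 (hμ κ γ hκ hγ hγ' D).2

/-- **Route T's count `GeneratorCountGE W p B` (`p^B ≤ #(X/𝔪X)`) is `AlgebraicLambdaGE W p B` at a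
member where `X` is torsion with `μ = 0` and has no nonzero finite `Λ`-submodule**:
`p^B ≤ #(X/𝔪X) ≤ p^{λ(X)}` (`X ≅ ℤ_p^λ`, tree `natCard_quotient_maximalIdeal_le_pow_lambdaInvariant`).
[cite: GreenbergLNM1716, p. 137 and Prop. 4.14 / 4.15] [cite: Washington1997, §13.2] -/
theorem algebraicLambdaGE_of_generatorCountGE {B : ℕ}
    (hμ : ∀ (κ : ZpExtension ℚ p) (γ : Field.absoluteGaloisGroup ℚ), κ.IsCyclotomic →
      κ.IsTopGenerator γ → IsCyclotomicVariable p γ →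
      ∀ (D : W.SelmerDualData κ γ) [Module.Finite (IwasawaAlgebra p) D.X], D.IsTorsion ∧ D.mu = 0)
    (hnf : NoFiniteSubmoduleAt p W) (hB : GeneratorCountGE W p B) : AlgebraicLambdaGE W p B :=
  algebraicLambdaGE_of_forall_normalised fun κ γ hκ hγ hγ' D _ ↦ by
    obtain ⟨hXt, hμ0⟩ := hμ κ γ hκ hγ hγ' D
    have hXtors : Module.IsTorsion (IwasawaAlgebra p) D.X := hXt
    have hle := X1.GeneratorCountLambda.natCard_quotient_maximalIdeal_le_pow_lambdaInvariant D.X hXtors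
      hμ0 (hnf hκ hγ hγ' D hXt)
    exact (Nat.pow_le_pow_iff_right (Nat.Prime.one_lt hp.out)).mp ((hB κ γ hκ hγ hγ' D hXt).trans hle)

/-- **At a `μ ≥ 1` member the count still bounds `λ`: `GeneratorCountGE W p B` and `μ(X) ≤ m` give
`AlgebraicLambdaGE W p (B − m)`** — GREENBERG'S INEQUALITY `#(X/𝔪X) ≤ p^{λ(X)+μ(X)}` for a torsion `X`
without nonzero finite submodules (tree `X1.GeneratorBoundMu.natCard_quotient_maximalIdeal_le_pow_lambda_add_mu`),
so `B ≤ λ + μ ≤ λ + m`. This is the reading route T's census uses at the `μ_an ≥ 1` members of a class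
(`λ_alg + p^0·μ ≥ t₀ + a − 2δ`). [cite: GreenbergLNM1716, p. 137 (λ_E + μ_E ≥ dim X/𝔪X)] -/
theorem algebraicLambdaGE_sub_of_generatorCountGE_of_mu_le {B m : ℕ}
    (hμ : ∀ (κ : ZpExtension ℚ p) (γ : Field.absoluteGaloisGroup ℚ), κ.IsCyclotomic →
      κ.IsTopGenerator γ → IsCyclotomicVariable p γ →
      ∀ (D : W.SelmerDualData κ γ) [Module.Finite (IwasawaAlgebra p) D.X], D.IsTorsion ∧ D.mu ≤ m)
    (hnf : NoFiniteSubmoduleAt p W) (hB : GeneratorCountGE W p B) : AlgebraicLambdaGE W p (B - m) :=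
  algebraicLambdaGE_of_forall_normalised fun κ γ hκ hγ hγ' D _ ↦ by
    obtain ⟨hXt, hμm⟩ := hμ κ γ hκ hγ hγ' D
    have hXtors : Module.IsTorsion (IwasawaAlgebra p) D.X := hXt
    have hle := X1.GeneratorBoundMu.natCard_quotient_maximalIdeal_le_pow_lambda_add_mu D.X hXtors
      (hnf hκ hγ hγ' D hXt)
    have hBle : B ≤ lambdaInvariant p D.X + muInvariant p D.X :=
      (Nat.pow_le_pow_iff_right (Nat.Prime.one_lt hp.out)).mp ((hB κ γ hκ hγ hγ' D hXt).trans hle)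
    have hμm' : muInvariant p D.X ≤ m := hμm
    omega

/-! ## §2. X2: a MULTIPLICATIVE Eisenstein prime (`p ‖ N` odd, `E[p]` reducible) — crux 3's currency -/

section X2

/-- **`X(E/ℚ_∞)` is torsion and `μ(X) ≤ m` at a member with `μ_an ≤ m`** (`p ‖ N` odd, `E[p]`
reducible): Wuthrich Thm. 16 (`hWu`: `X` torsion, `ι(T^e·g) = ϖ·L` with `g ∈ char X = (f_E)`) and the
certificate `X2.AnalyticMuLE W p m` (a coefficient of `ϖ·L` of norm `> p^{-(m+1)}`) give
`μ(f_E) ≤ μ(T^e·g) ≤ m` — Kato's direction only. The case `m = 0` is b2b's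
`X2.isTorsion_and_mu_eq_zero_of_analyticMuLE_zero`. [cite: Wuthrich2014, Thm. 16 and §5 (p. 397)]
[cite: GreenbergVatsal2000, p. 2, (2)] -/
theorem X2.isTorsion_and_mu_le_of_analyticMuLE
    (hWu : thm16_charIdeal_dvd_multiplicative_of_reducible)
    (hpar : nonempty_modularParametrizationData) (hp2 : p ≠ 2)
    (hmult : W.HasMultiplicativeReductionAtPrime p) (hred : ¬ W.HasIrreducibleModPGaloisRep p)
    {m : ℕ} (hμ : X2.AnalyticMuLE W p m) {κ : ZpExtension ℚ p} {γ : Field.absoluteGaloisGroup ℚ}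
    (hκ : κ.IsCyclotomic) (hγ : κ.IsTopGenerator γ) (hγ' : IsCyclotomicVariable p γ)
    (D : W.SelmerDualData κ γ) : D.IsTorsion ∧ D.mu ≤ m := by
  haveI : NeZero (W.conductorNorm ℤ) := ⟨(W.conductorNorm_pos_holds).ne'⟩
  haveI : Module.Finite (IwasawaAlgebra p) D.X := D.module_finite_holds hγ
  obtain ⟨Dm⟩ := hpar W
  have hf : IsNewformOf W Dm.f := Dm.isNewformOf
  obtain ⟨ϖ, -, hϖ, -⟩ := Dm.exists_rat_mul_realPeriodRat_eq_plusPeriod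
  obtain ⟨hX, hKns, hKs⟩ := hWu W p hp2 hmult hred hκ hγ hγ' hf D ϖ hϖ
  obtain ⟨fE, hfE⟩ := (charIdeal_isPrincipal_holds p D.X).principal
  have hchar : D.charIdeal = Ideal.span {fE} := hfE
  -- reading `μ(u · g) ≤ m` with `g = h · fE` on `fE`
  have read : ∀ (u g : IwasawaAlgebra p) (L : PowerSeries ℚ_[p]), u ≠ 0 → g ∈ D.charIdeal →
      (W.HasSplitMultiplicativeReductionAtPrime p → IsSplitMultPAdicLFunctionOf Dm.f p L) →
      (¬ W.HasSplitMultiplicativeReductionAtPrime p → IsMultPAdicLFunctionOf Dm.f p (-1) L) →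
      iwasawaToPowerSeries p (u * g) = PowerSeries.C ((ϖ : ℚ) : ℚ_[p]) * L → D.mu ≤ m := by
    intro u g L hu0 hgmem hLs hLn hι
    have hgmem' : g ∈ Ideal.span {fE} := by rw [← hchar]; exact hgmem
    obtain ⟨h, hgh⟩ := Ideal.mem_span_singleton'.mp hgmem'
    obtain ⟨k', hk'⟩ := hμ Dm.f hf ϖ hϖ L hLs hLn
    have hL0 : PowerSeries.C ((ϖ : ℚ) : ℚ_[p]) * L ≠ 0 := X2.ne_zero_of_lt_norm_coeff hk'
    have hG0 : u * g ≠ 0 := by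
      intro h0; apply hL0; rw [← hι, h0, map_zero]
    have hg0 : g ≠ 0 := fun h0 ↦ hG0 (by rw [h0, mul_zero])
    have hh0 : h ≠ 0 := fun h0 ↦ hg0 (by rw [← hgh, h0, zero_mul])
    have hfE0 : fE ≠ 0 := fun h0 ↦ hg0 (by rw [← hgh, h0, mul_zero])
    rw [← hι] at hk'
    have hμG : mu (u * g) ≤ m := X1.MuPart.mu_le_of_lt_norm_coeff hk'
    have h1 : mu fE ≤ mu (u * g) := by
      rw [← hgh, ← mul_assoc]
      exact (mu_le_mu_mul hfE0 (mul_ne_zero hu0 hh0)).trans_eq (by rw [mul_comm])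
    rw [SelmerDualData.mu, ← X1.MuPart.mu_generator_eq_muInvariant D.X hX hfE0 hchar]
    exact h1.trans hμG
  refine ⟨hX, ?_⟩
  by_cases hsplit : W.HasSplitMultiplicativeReductionAtPrime p
  · obtain ⟨L, hL⟩ := exists_isSplitMultPAdicLFunctionOf hsplit hf
    obtain ⟨g, hgmem, hι⟩ := hKs hsplit L hL
    exact read PowerSeries.X g L PowerSeries.X_ne_zero hgmem (fun _ ↦ hL)
      (fun hns ↦ absurd hsplit hns) hι
  · obtain ⟨L, hL⟩ := exists_isMultPAdicLFunctionOf_neg_one_of_nonsplit hf hmult hsplit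
    obtain ⟨g, hgmem, hι⟩ := hKns hsplit L hL
    exact read 1 g L one_ne_zero hgmem (fun hs ↦ absurd hs hsplit) (fun _ ↦ hL)
      (by rw [one_mul]; exact hι)

/-- **`NoFiniteSubmoduleAt p W` BY NAME from Greenberg 1999 Prop. 4.15 (ii) at an odd MULTIPLICATIVE
prime** (`F = ℚ`; no hypothesis on `E(ℚ)_tors` — contrast Prop. 4.14): every finite `Λ`-submodule of a
torsion `X(E/ℚ_∞)` is `0`. The good ordinary twin is
`X1.GeneratorCountSqueezeFacts.noFiniteSubmoduleAt_of_prop415ii`. [cite: GreenbergLNM1716, Prop. 4.15 (ii)] -/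
theorem noFiniteSubmoduleAt_of_prop415ii_mult
    (h415 : prop415ii_noFiniteSubmodule_of_ordinary_or_multiplicative) (hp2 : p ≠ 2)
    (hmult : W.HasMultiplicativeReductionAtPrime p) : NoFiniteSubmoduleAt p W :=
  have hp3 : 3 ≤ p := by
    have h2 := hp.out.two_le
    omega
  fun hκ hγ _ D _ hXt N hN ↦ h415 W p hp3 (Or.inr hmult) _ _ hκ hγ D hXt N hN

/-- **X2: `BudgetLeLambdaAt p W b ⇒ AlgebraicLambdaGE W p b` at a `μ_an = 0` member of an X2 class.**
[cite: GreenbergLNM1716, §5 pp. 114–118, p. 137] [cite: Wuthrich2014, Thm. 16 (p. 397)] -/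
theorem X2.algebraicLambdaGE_of_budgetLeLambdaAt_of_analyticMuLE_zero
    (hWu : thm16_charIdeal_dvd_multiplicative_of_reducible)
    (hpar : nonempty_modularParametrizationData) (hp2 : p ≠ 2)
    (hmult : W.HasMultiplicativeReductionAtPrime p) (hred : ¬ W.HasIrreducibleModPGaloisRep p)
    (hμ0 : X2.AnalyticMuLE W p 0) {b : ℕ} (hb : BudgetLeLambdaAt p W b) : AlgebraicLambdaGE W p b :=
  algebraicLambdaGE_of_budgetLeLambdaAt
    (fun _ _ hκ hγ hγ' D _ ↦ X2.isTorsion_and_mu_eq_zero_of_analyticMuLE_zero hWu hpar hp2 hmult hred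
      hμ0 hκ hγ hγ' D) hb

/-- **X2: `GeneratorCountGE W p B` at a member with `μ_an ≤ m` ⇒ `AlgebraicLambdaGE W p (B − m)`**
(Greenberg's inequality; Prop. 4.15 (ii) at `p ‖ N` BY NAME; Wuthrich Thm. 16). At `m = 0` this is
`AlgebraicLambdaGE W p B`. [cite: GreenbergLNM1716, p. 137 and Prop. 4.15 (ii)] [cite: Wuthrich2014, Thm. 16 (p. 397)] -/
theorem X2.algebraicLambdaGE_of_generatorCountGE_of_analyticMuLE
    (hWu : thm16_charIdeal_dvd_multiplicative_of_reducible)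
    (hpar : nonempty_modularParametrizationData)
    (h415 : prop415ii_noFiniteSubmodule_of_ordinary_or_multiplicative) (hp2 : p ≠ 2)
    (hmult : W.HasMultiplicativeReductionAtPrime p) (hred : ¬ W.HasIrreducibleModPGaloisRep p)
    {m B : ℕ} (hμ : X2.AnalyticMuLE W p m) (hB : GeneratorCountGE W p B) :
    AlgebraicLambdaGE W p (B - m) :=
  algebraicLambdaGE_sub_of_generatorCountGE_of_mu_le
    (fun _ _ hκ hγ hγ' D _ ↦ X2.isTorsion_and_mu_le_of_analyticMuLE hWu hpar hp2 hmult hred hμ hκ hγ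
      hγ' D) (noFiniteSubmoduleAt_of_prop415ii_mult h415 hp2 hmult) hB

/-- **X2: route M's membership `AlgebraicLambdaMem W p [k, ∞)` at an X2 pair ⇒ `AlgebraicLambdaGE W p k`**
(torsion at the normalised data by Wuthrich Thm. 16; any `AnalyticMuLE W p m` is only used to
instantiate the data). [cite: Wuthrich2014, Thm. 16 (p. 397)] -/
theorem X2.algebraicLambdaGE_of_algebraicLambdaMem_Ici_of_analyticMuLE
    (hWu : thm16_charIdeal_dvd_multiplicative_of_reducible)
    (hpar : nonempty_modularParametrizationData) (hp2 : p ≠ 2)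
    (hmult : W.HasMultiplicativeReductionAtPrime p) (hred : ¬ W.HasIrreducibleModPGaloisRep p)
    {m k : ℕ} (hμ : X2.AnalyticMuLE W p m) (h : AlgebraicLambdaMem W p (Set.Ici k)) :
    AlgebraicLambdaGE W p k :=
  algebraicLambdaGE_of_algebraicLambdaMem_Ici
    (fun _ _ hκ hγ hγ' D _ ↦ (X2.isTorsion_and_mu_le_of_analyticMuLE hWu hpar hp2 hmult hred hμ hκ hγ
      hγ' D).1) h

/-- **X2, END-TO-END at layer `0` — Greenberg's Cor. 5.6 road at `p ‖ N` IN THE KERNEL.** Data: `p` odd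
of multiplicative reduction, `E[p]` reducible, `p ∤ #E(ℚ)_tors` (`δ = 0`), a finite set `S` of places
`v ∤ p` with `p ∣ c_v(E)` (Tamagawa witnesses: additive or split multiplicative `v`, Kodaira–Néron, tree
theorems), and the certificate `μ_an ≤ m` (`X2.AnalyticMuLE W p m`). Conclusion:
`AlgebraicLambdaGE W p (#S − m)` — `p^{#S} ≤ #(X/𝔪X) ≤ p^{λ+μ}`, `μ ≤ μ_an ≤ m`. Named facts:
Poitou–Tate duality over `ℚ` (`hPT`), Greenberg Prop. 4.15 (ii) (`h415`), Wuthrich Thm. 16 (`hWu`),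
modularity (`hpar`); the local Euler–Poincaré formula over `ℚ` is a tree theorem. This is the `t₀ − μ`
part of route T's recipe `λ_alg ≥ t_m + a − 2δ − p^m μ` (b2b eisenstein-p2 `routeT/README.md`) at
`m = 0`, `δ = 0`, without the `a`-term. [cite: GreenbergLNM1716, §3 p. 88, §5 pp. 114–118, p. 137]
[cite: SilvermanATAEC1994, Cor. IV.9.2(d), IV.9.4 Step 2] [cite: Wuthrich2014, Thm. 16 (p. 397)] -/
theorem X2.algebraicLambdaGE_of_dvd_localTamagawaNumber (hp2 : p ≠ 2)
    (hPT : poitouTate_selmerStructure_duality ℚ)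
    (h415 : prop415ii_noFiniteSubmodule_of_ordinary_or_multiplicative)
    (hWu : thm16_charIdeal_dvd_multiplicative_of_reducible)
    (hpar : nonempty_modularParametrizationData)
    (hmult : W.HasMultiplicativeReductionAtPrime p) (hred : ¬ W.HasIrreducibleModPGaloisRep p)
    (htors : ¬ p ∣ W.torsionOrder) (S : Finset (HeightOneSpectrum (𝓞 ℚ)))
    (hSp : ∀ v ∈ S, ((p : ℕ) : 𝓞 ℚ) ∉ v.asIdeal)
    (hcv : ∀ v ∈ S,
      p ∣ (W.baseChange (v.adicCompletion ℚ)).localTamagawaNumber (v.adicCompletionIntegers ℚ))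
    {m : ℕ} (hμ : X2.AnalyticMuLE W p m) : AlgebraicLambdaGE W p (S.card - m) :=
  X2.algebraicLambdaGE_of_generatorCountGE_of_analyticMuLE hWu hpar h415 hp2 hmult hred hμ
    (X1.GeneratorCountTamagawa.generatorCountGE_of_dvd_localTamagawaNumber hp2 hPT htors S hSp hcv)

/-- **X2, END-TO-END over the LAYERS at a `μ_an = 0` member — the tower count.** Same pair data with
`μ_an = 0`, and for each `v ∈ S`: `v ∤ p`, a place-count certificate `v_p(N(v)^{p−1} − 1) = m_v + 1`
(`s_v = p^{m_v}` primes above `v` high in the tower), `p ∣ c_v(E)`, additive or split multiplicative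
reduction at `v`. Conclusion: `AlgebraicLambdaGE W p (Σ_{v ∈ S} p^{min(n, m_v)})` for every `n` — n1011's
no-Tate layer budget (`Additive.budgetLeLambdaAt_layer_of_certificates_noTate`: Poitou–Tate pair
counting over `ℚ_n`, restriction `ℚ_n → ℚ_∞` with controlled kernel) made a route-T certificate at
`p ‖ N`. Named facts: Prop. 4.14 (`h414`, needs `p ∤ #E(ℚ)_tors`), Poitou–Tate duality and the local
Euler–Poincaré formula over `ℚ_n` (`hPT`, `hEP`), Wuthrich Thm. 16, modularity.
[cite: GreenbergLNM1716, §5 pp. 114–118 (proof of Cor. 5.6), Prop. 4.14, p. 137] [cite: Washington1997, §13.1, Prop. 13.2]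
[cite: Wuthrich2014, Thm. 16 (p. 397)] -/
theorem X2.algebraicLambdaGE_layer_of_certificates (hp2 : p ≠ 2)
    (h414 : prop414_noFiniteSubmodule_of_not_dvd_torsionOrder)
    (hWu : thm16_charIdeal_dvd_multiplicative_of_reducible)
    (hpar : nonempty_modularParametrizationData)
    (hmult : W.HasMultiplicativeReductionAtPrime p) (hred : ¬ W.HasIrreducibleModPGaloisRep p)
    (htors : ¬ p ∣ W.torsionOrder) (n : ℕ)
    (hPT : ∀ (κ : ZpExtension ℚ p) [NumberField (κ.layer n)], κ.IsCyclotomic →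
      poitouTate_selmerStructure_duality (κ.layer n))
    (hEP : ∀ (κ : ZpExtension ℚ p) [NumberField (κ.layer n)], κ.IsCyclotomic →
      ∀ w : HeightOneSpectrum (𝓞 (κ.layer n)),
      localEulerPoincareCharacteristic (w.adicCompletion (κ.layer n)))
    (S : Finset (HeightOneSpectrum (𝓞 ℚ))) (mv : HeightOneSpectrum (𝓞 ℚ) → ℕ)
    (hSp : ∀ v ∈ S, ((p : ℕ) : 𝓞 ℚ) ∉ v.asIdeal)
    (hval : ∀ v ∈ S, padicValNat p (v.residueCard ^ (p - 1) - 1) = mv v + 1)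
    (hcv : ∀ v ∈ S,
      p ∣ (W.baseChange (v.adicCompletion ℚ)).localTamagawaNumber (v.adicCompletionIntegers ℚ))
    (hdat : ∀ v ∈ S, W.HasAdditiveReductionAt v ∨ W.HasSplitMultiplicativeReductionAt v)
    (hμ0 : X2.AnalyticMuLE W p 0) : AlgebraicLambdaGE W p (∑ v ∈ S, p ^ min n (mv v)) :=
  X2.algebraicLambdaGE_of_budgetLeLambdaAt_of_analyticMuLE_zero hWu hpar hp2 hmult hred hμ0
    (budgetLeLambdaAt_layer_of_certificates_noTate hp2 h414 htors n hPT hEP S mv hSp hval hcv hdat)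

/-- **X2 at the LOCATED member: a Tamagawa certificate at ANY member `W` of the class is a λ-lower
bound at every isogenous member `W₀`** (in particular at the off-locus member of `stub_locate`): the
layer-`0` end-to-end bound transported by `algebraicLambdaGE_of_isIsogenous` (g0, unconditional).
This is how route T's census reads `LB` at the best member of the class.
[cite: GreenbergLNM1716, §5 pp. 114–118, p. 137] [cite: GreenbergVatsal2000, §2 p. 28] -/
theorem X2.algebraicLambdaGE_of_isIsogenous_of_dvd_localTamagawaNumber
    {W₀ : WeierstrassCurve ℚ} [W₀.IsElliptic] [W₀.IsGloballyMinimal] (hiso : IsIsogenous W₀ W)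
    (hp2 : p ≠ 2) (hPT : poitouTate_selmerStructure_duality ℚ)
    (h415 : prop415ii_noFiniteSubmodule_of_ordinary_or_multiplicative)
    (hWu : thm16_charIdeal_dvd_multiplicative_of_reducible)
    (hpar : nonempty_modularParametrizationData)
    (hmult : W.HasMultiplicativeReductionAtPrime p) (hred : ¬ W.HasIrreducibleModPGaloisRep p)
    (htors : ¬ p ∣ W.torsionOrder) (S : Finset (HeightOneSpectrum (𝓞 ℚ)))
    (hSp : ∀ v ∈ S, ((p : ℕ) : 𝓞 ℚ) ∉ v.asIdeal)
    (hcv : ∀ v ∈ S,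
      p ∣ (W.baseChange (v.adicCompletion ℚ)).localTamagawaNumber (v.adicCompletionIntegers ℚ))
    {m : ℕ} (hμ : X2.AnalyticMuLE W p m) : AlgebraicLambdaGE W₀ p (S.card - m) :=
  algebraicLambdaGE_of_isIsogenous hiso
    (X2.algebraicLambdaGE_of_dvd_localTamagawaNumber hp2 hPT h415 hWu hpar hmult hred htors S hSp hcv hμ)

end X2

end Summit.BirchSwinnertonDyer.BirchSwinnertonDyer.Theorems.EisensteinPrimesAlgebraicLambdaGEBudget

end
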